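import Summits.BirchSwinnertonDyer.BirchSwinnertonDyer.Theorems.SignedLowerHalvesKobayashiMainConjectureSmallImageTeichSpanHeckeRelatorDefs
import Summits.BirchSwinnertonDyer.BirchSwinnertonDyer.Theorems.SignedLowerHalvesKobayashiMainConjectureSmallImageTeichSpanLevelDescent
import HarnessLib

/-!
# Route `SignedLowerHalves`, crux `KobayashiMainConjectureSmallImage` (item stmt-BirchSwinnertonDyer-19002), line `birth_acns` v12,
# stub `stub_muOneSign_ns_ge5`: **LEVEL DESCENT for «B⁰ modulo a relator set»** (`TeichSpanGenMod`, `heckePImages`, `heckeLImages`,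
# `heckeRelators`; cell `bsd-ssimc`, seat `bsd-line-slh-p3` gen 10, LEAD; THEOREMS ONLY; helper)

The ideator bsd-idea-13 g11's level descent for CONJ B⁰ (`SmallImageTeichSpanLevelDescent.teichSpanGen_of_dvd`, landed by gen 9: a good
`γ ∈ Γ₀(N)` factors as `γ'·L` with `γ' ∈ Γ₀(N')` good and `L` unipotent; generators push forward along `Γ₀(N') ≤ Γ₀(N)`) carries over
VERBATIM to B⁰ modulo relators: the `T_p`-image words and the `T_ℓ`-image words of `Γ₀(N')` ARE such words of `Γ₀(N)` (same `b`- and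
`d`-entries).  So an attack on the sharpened hinge of `stub_muOneSign_ns_ge5` (`…TeichSpanHeckeMod`) may work at ANY ONE multiple `N'`
of the conductor prime to `p` (e.g. the torsion-free level `4N`, or `qN` with an auxiliary prime).

* `teichSpanGenMod_of_dvd` — `N ∣ N'`, `p ∤ N'`, `incl '' G' ⊆ G` ⊢ `TeichSpanGenMod N' p G' → TeichSpanGenMod N p G`.
* `image_incl_heckePImages_subset`, `image_incl_heckeLImages_subset` — the relator words push forward.
* `teichSpanGenModHecke_of_dvd` (B⁰_ss descends), `teichSpanGenMod_heckeRelators_of_dvd` (B⁰ modulo the Hecke relators of a form `f` of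
  level `N`, posed at level `N'` with `f`'s eigenvalue data, descends to `heckeRelators f p` at level `N`).
HONEST SCOPE: implications between instances of an OPEN hypothesis; nothing about any curve or form is asserted; BSD is not proved by any of
this; no summit statement is proved by this seat.
References: [Manin1972] Prop. 1.4; [Sun2007] §4; [MazurTateTeitelbaum1986Invent] §I.4 (4.2).
-/

-- D-0017: single-problem summit, the namespace repeats the problem name by design.
set_option linter.dupNamespace false
set_option autoImplicit false

noncomputable section

open scoped Classical MatrixGroups ModularForm commutatorElement
open CongruenceSubgroup Literature.NumberTheory.EllipticCurves.Rank1Residual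

namespace Summit.BirchSwinnertonDyer.BirchSwinnertonDyer.Theorems.SmallImageTeichSpanHeckeLevelDescent

open Literature.NumberTheory.EllipticCurves Literature.NumberTheory.EllipticCurves.ModularForms
  Summit.BirchSwinnertonDyer.BirchSwinnertonDyer.Cruxes.AnalyticMuZeroX9.TeichSpan
  Summit.BirchSwinnertonDyer.BirchSwinnertonDyer.Theorems.SmallImageTeichSpanHecke
  Summit.BirchSwinnertonDyer.BirchSwinnertonDyer.Theorems.SmallImageTeichSpanLevelDescent

variable {N N' : ℕ}

/-! ### §1 Generators and relators push forward along `Γ₀(N') ≤ Γ₀(N)` -/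

/-- `⟨B⁰ generators ∪ G'⟩·[Γ₀(N'),Γ₀(N')]` pushes forward into `⟨B⁰ generators ∪ G⟩·[Γ₀(N),Γ₀(N)]` whenever `incl '' G' ⊆ G`.
[cite: Manin1972, Prop. 1.4] -/
theorem map_closure_union_sup_commutator_le (h : N ∣ N') (p : ℕ) {G' : Set (Gamma0 N')} {G : Set (Gamma0 N)}
    (hGG : Subgroup.inclusion (gamma0_le_of_dvd h) '' G' ⊆ G) :
    (Subgroup.closure (teichSpanGenerators N' p ∪ G') ⊔ commutator (Gamma0 N')).map (Subgroup.inclusion (gamma0_le_of_dvd h)) ≤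
      Subgroup.closure (teichSpanGenerators N p ∪ G) ⊔ commutator (Gamma0 N) := by
  rw [Subgroup.map_sup]
  apply sup_le_sup
  · rw [MonoidHom.map_closure]
    apply Subgroup.closure_mono
    rintro _ ⟨γ, hγ, rfl⟩
    rcases hγ with hγ | hγ
    · exact Or.inl (incl_mem_teichSpanGenerators h hγ)
    · exact Or.inr (hGG ⟨γ, hγ, rfl⟩)
  · rw [commutator_def, commutator_def, Subgroup.map_commutator]
    exact Subgroup.commutator_mono le_top le_top

/-- **The `T_p`-image words push forward**: `incl '' heckePImages N' p ⊆ heckePImages N p` (same entries, same lifts, same drop).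
[cite: MazurTateTeitelbaum1986Invent, §I.4 (4.2)] -/
theorem image_incl_heckePImages_subset (h : N ∣ N') (p : ℕ) :
    Subgroup.inclusion (gamma0_le_of_dvd h) '' heckePImages N' p ⊆ heckePImages N p := by
  rintro _ ⟨R, ⟨n, b, l, δ, hlen, hl, hnd, hdδ, hbδ, rfl⟩, rfl⟩
  rw [map_mul, map_list_prod]
  refine ⟨n, b, l.map (Subgroup.inclusion (gamma0_le_of_dvd h)), Subgroup.inclusion (gamma0_le_of_dvd h) δ,
    by rw [List.length_map, hlen], ?_, ?_, hdδ, hbδ, rfl⟩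
  · intro g hg
    obtain ⟨g', hg', rfl⟩ := List.mem_map.mp hg
    exact hl g' hg'
  · rw [List.map_map]
    exact hnd

/-- **The `T_ℓ`-image words push forward**: `incl '' heckeLImages N' p ℓ ⊆ heckeLImages N p ℓ`.
[cite: MazurTateTeitelbaum1986Invent, §I.4 (4.2)] -/
theorem image_incl_heckeLImages_subset (h : N ∣ N') (p ℓ : ℕ) :
    Subgroup.inclusion (gamma0_le_of_dvd h) '' heckeLImages N' p ℓ ⊆ heckeLImages N p ℓ := by
  rintro _ ⟨R, ⟨n, b, g, gℓ, hg, hdℓ, hbℓ, rfl⟩, rfl⟩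
  rw [map_mul, map_list_prod, List.map_ofFn]
  exact ⟨n, b, Subgroup.inclusion (gamma0_le_of_dvd h) ∘ g, Subgroup.inclusion (gamma0_le_of_dvd h) gℓ,
    fun j ↦ hg j, hdℓ, hbℓ, rfl⟩

/-! ### §2 Level descent -/

/-- **LEVEL DESCENT for B⁰ modulo relators.**  For `N ∣ N'`, `p ∤ N'`, relator sets `G' ⊆ Γ₀(N')`, `G ⊆ Γ₀(N)` with `incl '' G' ⊆ G`:
`TeichSpanGenMod N' p G' → TeichSpanGenMod N p G`.  (A good `γ ∈ Γ₀(N)` is `γ'·L`, `γ' ∈ Γ₀(N')` good, `L` of trace `2`;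
`x y x^ι y^ι = (x x^ι)·⁅(x^ι)⁻¹, y⁆·y·y^ι`; §1.)  [cite: Manin1972, Prop. 1.4] [cite: Sun2007, §4] -/
theorem teichSpanGenMod_of_dvd (h : N ∣ N') {p : ℕ} (hp : p.Prime) (hpN' : ¬ p ∣ N') {G' : Set (Gamma0 N')} {G : Set (Gamma0 N)}
    (hGG : Subgroup.inclusion (gamma0_le_of_dvd h) '' G' ⊆ G) (hB : TeichSpanGenMod N' p G') : TeichSpanGenMod N p G := by
  intro γ hγ
  obtain ⟨γ', L, hγ', hL, rfl⟩ := exists_eq_incl_mul_of_isGoodAt h hp hpN' hγ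
  set S := Subgroup.closure (teichSpanGenerators N p ∪ G) ⊔ commutator (Gamma0 N) with hS_def
  have hx : Subgroup.inclusion (gamma0_le_of_dvd h) γ' * iotaGamma0 (Subgroup.inclusion (gamma0_le_of_dvd h) γ') ∈ S := by
    have h1 := hB γ' hγ'
    have h2 : Subgroup.inclusion (gamma0_le_of_dvd h) (γ' * iotaGamma0 γ') ∈ S :=
      map_closure_union_sup_commutator_le h p hGG (Subgroup.mem_map_of_mem (Subgroup.inclusion (gamma0_le_of_dvd h)) h1)
    rwa [map_mul, incl_iotaGamma0 h] at h2
  have hy : L ∈ S :=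
    Subgroup.mem_sup_left (Subgroup.subset_closure (Or.inl (mem_teichSpanGenerators_of_trEntry (Or.inl hL))))
  have hy' : iotaGamma0 L ∈ S :=
    Subgroup.mem_sup_left (Subgroup.subset_closure
      (Or.inl (mem_teichSpanGenerators_of_trEntry (Or.inl (by rw [trEntry_iotaGamma0]; exact hL)))))
  have hc : ⁅(iotaGamma0 (Subgroup.inclusion (gamma0_le_of_dvd h) γ'))⁻¹, L⁆ ∈ S :=
    Subgroup.mem_sup_right (Subgroup.commutator_mem_commutator (Subgroup.mem_top _) (Subgroup.mem_top _))
  rw [iotaGamma0_mul]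
  have key : Subgroup.inclusion (gamma0_le_of_dvd h) γ' * L * (iotaGamma0 (Subgroup.inclusion (gamma0_le_of_dvd h) γ') * iotaGamma0 L)
      = (Subgroup.inclusion (gamma0_le_of_dvd h) γ' * iotaGamma0 (Subgroup.inclusion (gamma0_le_of_dvd h) γ')) *
          ⁅(iotaGamma0 (Subgroup.inclusion (gamma0_le_of_dvd h) γ'))⁻¹, L⁆ * L * iotaGamma0 L := by
    simp only [commutatorElement_def]; group
  rw [key]
  exact Subgroup.mul_mem _ (Subgroup.mul_mem _ (Subgroup.mul_mem _ hx hc) hy) hy'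

/-- **B⁰_ss descends**: `N ∣ N'`, `p ∤ N'` ⊢ `TeichSpanGenModHecke N' p → TeichSpanGenModHecke N p`.
[cite: Manin1972, Prop. 1.4] [cite: MazurTateTeitelbaum1986Invent, §I.4 (4.2)] -/
theorem teichSpanGenModHecke_of_dvd (h : N ∣ N') {p : ℕ} (hp : p.Prime) (hpN' : ¬ p ∣ N') (hB : TeichSpanGenModHecke N' p) :
    TeichSpanGenModHecke N p :=
  (teichSpanGenModHecke_iff_teichSpanGenMod N p).mpr
    (teichSpanGenMod_of_dvd h hp hpN' (image_incl_heckePImages_subset h p) ((teichSpanGenModHecke_iff_teichSpanGenMod N' p).mp hB))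

/-- **B⁰ modulo the Hecke relators descends.**  For a form `f` of level `N`, `N ∣ N'`, `p ∤ N'`: B⁰ at level `N'` modulo the `T_p`-images
and the `T_ℓ`-images of `Γ₀(N')` for the primes `ℓ ≠ p`, `ℓ ∤ N` with `p ∣ a_ℓ(f) ∈ ℤ` implies `TeichSpanGenMod N p (heckeRelators f p)`.
(At level `N'` the `T_ℓ`-words for `ℓ ∣ N'` carry no information — they are still admissible relators of `Γ₀(N)`.)
[cite: Manin1972, Prop. 1.4] [cite: MazurTateTeitelbaum1986Invent, §I.4 (4.2)] -/
theorem teichSpanGenMod_heckeRelators_of_dvd [NeZero N] (f : CuspForm (Gamma0 N) 2) (h : N ∣ N') {p : ℕ} (hp : p.Prime)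
    (hpN' : ¬ p ∣ N')
    (hB : TeichSpanGenMod N' p (heckePImages N' p ∪
      ⋃ ℓ ∈ {ℓ : ℕ | ℓ.Prime ∧ ℓ ≠ p ∧ ¬ ℓ ∣ N ∧ ∃ a : ℤ, cuspCoeff f ℓ = (a : ℂ) ∧ (p : ℤ) ∣ a}, heckeLImages N' p ℓ)) :
    TeichSpanGenMod N p (heckeRelators f p) := by
  refine teichSpanGenMod_of_dvd h hp hpN' ?_ hB
  rintro _ ⟨R, hR, rfl⟩
  rcases hR with hR | hR
  · exact heckePImages_subset_heckeRelators f p (image_incl_heckePImages_subset h p ⟨R, hR, rfl⟩)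
  · simp only [Set.mem_iUnion, Set.mem_setOf_eq, exists_prop] at hR
    obtain ⟨ℓ, ⟨hℓ, hℓp, hℓN, a, ha, hpa⟩, hRℓ⟩ := hR
    exact heckeLImages_subset_heckeRelators hℓ hℓp hℓN ha hpa (image_incl_heckeLImages_subset h p ℓ ⟨R, hRℓ, rfl⟩)

/-! ### Appended (gen 11): the third cut (eigen-relators) descends too -/

/-- **The eigen-corrected `T_ℓ`-image words push forward**: `incl '' heckeEigenLImages N' p ℓ a ⊆ heckeEigenLImages N p ℓ a` (same entries;
the base-cusp factor `γ^{−a}` maps to `(incl γ)^{−a}`). [cite: MazurTateTeitelbaum1986Invent, §I.4 (4.2)] -/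
theorem image_incl_heckeEigenLImages_subset (h : N ∣ N') (p ℓ : ℕ) (a : ℤ) :
    Subgroup.inclusion (gamma0_le_of_dvd h) '' heckeEigenLImages N' p ℓ a ⊆ heckeEigenLImages N p ℓ a := by
  rintro _ ⟨R, ⟨n, b, g, gℓ, γ, hg, hdℓ, hbℓ, hdγ, hbγ, rfl⟩, rfl⟩
  rw [map_mul, map_mul, map_list_prod, List.map_ofFn, map_zpow]
  exact ⟨n, b, Subgroup.inclusion (gamma0_le_of_dvd h) ∘ g, Subgroup.inclusion (gamma0_le_of_dvd h) gℓ,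
    Subgroup.inclusion (gamma0_le_of_dvd h) γ, fun j ↦ hg j, hdℓ, hbℓ, hdγ, hbγ, rfl⟩

/-- **B⁰ modulo the EIGEN-relators descends.**  For a form `f` of level `N`, `N ∣ N'`, `p ∤ N'`: B⁰ at level `N'` modulo the `T_p`-images,
the `T_ℓ`-images for the primes with `p ∣ a_ℓ(f)`, and the eigen-corrected `T_ℓ`-image words of `Γ₀(N')` for EVERY prime `ℓ ≠ p`, `ℓ ∤ N`
with `a_ℓ(f) = a ∈ ℤ`, implies `TeichSpanGenMod N p (heckeEigenRelators f p)` — so the exact hinge of child 23117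
(`…TeichSpanHeckeEigen.muOneSign_ns_ge5_of_teichSpanGenMod_heckeEigenRelators_conductor`) may be attacked at ANY ONE multiple of the conductor
prime to `p` (e.g. the torsion-free level `4N_E`). [cite: Manin1972, Prop. 1.4] [cite: MazurTateTeitelbaum1986Invent, §I.4 (4.2)] -/
theorem teichSpanGenMod_heckeEigenRelators_of_dvd [NeZero N] (f : CuspForm (Gamma0 N) 2) (h : N ∣ N') {p : ℕ} (hp : p.Prime)
    (hpN' : ¬ p ∣ N')
    (hB : TeichSpanGenMod N' p ((heckePImages N' p ∪
      ⋃ ℓ ∈ {ℓ : ℕ | ℓ.Prime ∧ ℓ ≠ p ∧ ¬ ℓ ∣ N ∧ ∃ a : ℤ, cuspCoeff f ℓ = (a : ℂ) ∧ (p : ℤ) ∣ a}, heckeLImages N' p ℓ) ∪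
      ⋃ x ∈ {x : ℕ × ℤ | x.1.Prime ∧ x.1 ≠ p ∧ ¬ x.1 ∣ N ∧ cuspCoeff f x.1 = (x.2 : ℂ)}, heckeEigenLImages N' p x.1 x.2)) :
    TeichSpanGenMod N p (heckeEigenRelators f p) := by
  refine teichSpanGenMod_of_dvd h hp hpN' ?_ hB
  rintro _ ⟨R, hR, rfl⟩
  rcases hR with (hR | hR) | hR
  · exact heckeRelators_subset_heckeEigenRelators f p
      (heckePImages_subset_heckeRelators f p (image_incl_heckePImages_subset h p ⟨R, hR, rfl⟩))
  · simp only [Set.mem_iUnion, Set.mem_setOf_eq, exists_prop] at hR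
    obtain ⟨ℓ, ⟨hℓ, hℓp, hℓN, a, ha, hpa⟩, hRℓ⟩ := hR
    exact heckeRelators_subset_heckeEigenRelators f p
      (heckeLImages_subset_heckeRelators hℓ hℓp hℓN ha hpa (image_incl_heckeLImages_subset h p ℓ ⟨R, hRℓ, rfl⟩))
  · simp only [Set.mem_iUnion, Set.mem_setOf_eq, exists_prop, Prod.exists] at hR
    obtain ⟨ℓ, a, ⟨hℓ, hℓp, hℓN, ha⟩, hRℓ⟩ := hR
    exact heckeEigenLImages_subset_heckeEigenRelators hℓ hℓp hℓN ha (image_incl_heckeEigenLImages_subset h p ℓ a ⟨R, hRℓ, rfl⟩)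

end Summit.BirchSwinnertonDyer.BirchSwinnertonDyer.Theorems.SmallImageTeichSpanHeckeLevelDescent

end
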